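import Summits.QuantumFields.YangMills.Theorems.TwistedTraceScaling.Negative.SoftTubeIffInner
import Summits.QuantumFields.YangMills.Theorems.TwistedTraceScaling.Negative.InnerBOPackageIffInner
import HarnessLib

/-!
# R27b (crux `TwistedTraceScaling`, stmt-QuantumFields-20203): lane A g12's tube package `SoftTubeBOPackageAt L χ` (p622264) and hard tube statement
# `TubeNoIntruderAt L T` (p620160) are EQUIVALENT to `SoftTubeNoIntruderAt` / `InnerNoIntruderOneOrbitAt L δ` — all four typed C4 interfaces coincide

Standing disprover `ym-cdisprove-20203-1` (gen 22); companion of `…Negative.SoftTubeIffInner` (R27).  VETTED (exact): lane A's ★★★ `softTubeNoIntruderAt_of_package`,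
`innerNoIntruderOneOrbitAt_of_tube`, `innerNoIntruderOneOrbitAt_of_softTubePackage`.  FINDING (kernel-checked):
* §1 ★ `softTubeBOPackageAt_of_softTubeNoIntruderAt` (EVERY weight `χ`): the TRIVIAL SPLIT `u = f`, `v = 0`, `θ = 1`, `b = 0`, `σ = e^{ελ_b/4}λ₀/μ₀` of R18 in tube currency
  (FLOOR with equality, STIFF and OFF-DIAGONAL read `0 ≤ 0`, SLOW MIN–MAX = the tube statement at `ε/2`); ★ `softTubeBOPackageAt_iff χ : SoftTubeBOPackageAt L χ ↔
  SoftTubeNoIntruderAt L χ`.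
* §2 ★★ `softTubeBOPackage_recordWeight_iff_inner (hδ) (δg) : SoftTubeBOPackageAt L (recordWeight L δ δg) ↔ InnerNoIntruderOneOrbitAt L δ` (every width `δg`);
  `softTubeBOPackage_recordWeight_iff_innerBOPackage : … ↔ InnerBOPackageAt L δ` (R18); `softTubeBOPackage_recordWeight_pow_iff (s t)`.
* §3 ★ `tubeNoIntruderAt_iff_soft : TubeNoIntruderAt L T ↔ SoftTubeNoIntruderAt L (𝟙_{T ·})`; ★★ `tubeNoIntruderAt_iff_inner`: for an admissible tube eventually inside the
  inner region (every sandwiched tube `nearOne ρ ∩ {orbitDist < δ β} ⊆ T β ⊆ {orbitDist < δ β}`), `TubeNoIntruderAt L T ↔ InnerNoIntruderOneOrbitAt L δ`.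
READING (paper).  As with `InnerBOPackageAt` (R18), the typed package's data `θ, σ, b, u, v` are unconstrained existentials: any proof of INNER instantiates all clauses, so
none of them is a disprover's target and C4-CORE has 0 typed bytes beyond INNER one-orbit itself; the clauses acquire content only once `u, v, σ, b, θ` are tied to NAMED
objects (fibrewise stiff Gaussian ground state, Mehler gap, first-order slow–stiff coupling) — then R21/R25/R26 apply.  NO KILL; no verdict changes.
HONEST FRAMING: structural lemmas about typed interfaces of a stub lane (S-BASE C4-CORE) of a child of the CONDITIONAL reduction route (femto rung R2b1); not
`¬TwistedTraceScaling`, not infinite volume, not a gap, not Clay.  Sorry-free, no new definition; axioms ⊆ {propext, Classical.choice, Quot.sound}.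

## References
* M. Lüscher, Nucl. Phys. B219 (1983) 233, §3 (Born–Oppenheimer reduction to the constant modes). [Luscher1983]
* E. Seiler, LNP 159 (1982), §2–3 (gauge averaging, Faddeev–Popov slices on the lattice). [SeilerLNP1982]
* J. Sjöstrand, M. Zworski, Ann. Inst. Fourier 57 (2007) 2095, §2 (Schur complement / Feshbach map). [SjostrandZworski2007]
-/

set_option autoImplicit false

noncomputable section

open MeasureTheory Filter Topology Real
open scoped BigOperators
open Literature.MathematicalPhysics.QuantumFieldTheory hiding SU2
open Literature.MathematicalPhysics.QuantumLattice
open Summit.QuantumFields.YangMills.Theorems.FemtoTransferGap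
open Summit.QuantumFields.YangMills.Theorems.FemtoTransferGap.TwoLattice.Avg
open Summit.QuantumFields.YangMills.Theorems.TwistedTraceScaling.Negative.R27

namespace Summit.QuantumFields.YangMills.Theorems.TwistedTraceScaling.Negative.R27b

variable {L : ℕ} [NeZero L]


/-! ## §1 ★ The soft tube statement implies the tube package (trivial split) -/

/-- The zero test function has zero tube norm. [folklore] -/
theorem tubeNormSq_zero_fun (w : GaugeConfig 3 L SU2 → ℝ) : tubeNormSq w (fun _ => (0 : ℝ)) = 0 := by
  simp [tubeNormSq]

/-- The zero test function has zero tube form. [folklore] -/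
theorem tubeForm_zero_fun (β : ℝ) : tubeForm β (fun _ : GaugeConfig 3 L SU2 => (0 : ℝ)) = 0 := by
  simp [tubeForm]

/-- The tube norm of the zero combination is `0`. [folklore] -/
theorem tubeNormSq_combination_zero {k : ℕ} (w : GaugeConfig 3 L SU2 → ℝ) (f : Fin k → GaugeConfig 3 L SU2 → ℝ) :
    tubeNormSq w (fun U => ∑ i, (0 : Fin k → ℝ) i * f i U) = 0 := by
  simp [tubeNormSq]

/-- ★ **`SoftTubeNoIntruderAt L χ → SoftTubeBOPackageAt L χ`** for EVERY weight `χ`, by the TRIVIAL SPLIT `u = f`, `v = 0`, `θ = 1`, `b = 0`,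
`σ = e^{ελ_b/4}λ₀/μ₀` (FLOOR with equality, STIFF and OFF-DIAGONAL read `0 ≤ 0`, SLOW MIN–MAX = the tube statement at `ε/2`) — R18's split in tube currency.
[cite: Luscher1983, §3] [cite: SjostrandZworski2007, §2] -/
theorem softTubeBOPackageAt_of_softTubeNoIntruderAt {χ : ℝ → GaugeConfig 3 L SU2 → ℝ} (hN : SoftTubeNoIntruderAt L χ) :
    SoftTubeBOPackageAt L χ := by
  intro k ε hε
  obtain ⟨β0, hβ0⟩ := hN k (ε / 2) (half_pos hε)
  refine ⟨1, one_pos, le_rfl, max β0 1, fun β hβ => ?_⟩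
  have hβ0' : β0 ≤ β := (le_max_left _ _).trans hβ
  have hβ1 : 1 ≤ β := (le_max_right _ _).trans hβ
  have hβpos : 0 < β := by linarith
  have hL0 : (0 : ℝ) < (L : ℝ) := by exact_mod_cast Nat.pos_of_ne_zero (NeZero.ne L)
  have hB : 0 < (L : ℝ) ^ 3 * β := by positivity
  have hμ0 : 0 < levelValue su2Rep 1 ((L : ℝ) ^ 3 * β) 0 := levelValue_su2Rep_pos hB 0
  have hΛ0 : 0 < levelValue su2Rep L β 0 := levelValue_zero_su2Rep_pos L β
  have hlam0 : 0 < bareLambda ((L : ℝ) ^ 3 * β) := bareLambda_pos' hB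
  set lam := bareLambda ((L : ℝ) ^ 3 * β) with hlam
  set μ0 := levelValue su2Rep 1 ((L : ℝ) ^ 3 * β) 0 with hμ0def
  set μk := levelValue su2Rep 1 ((L : ℝ) ^ 3 * β) k with hμkdef
  set Λ0 := levelValue su2Rep L β 0 with hΛ0def
  refine ⟨Real.exp (ε / 4 * lam) * Λ0 / μ0, 0, by positivity, le_rfl, ?_, ?_, ?_⟩
  · -- `b² = 0 ≤ εθλ_b/16`
    have : (0 : ℝ) ^ 2 = 0 := by norm_num
    rw [this]; positivity
  · -- FLOOR with equality: `e^{−ελ/4}·(σμ₀) = λ₀`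
    have hσμ : Real.exp (ε / 4 * lam) * Λ0 / μ0 * μ0 = Real.exp (ε / 4 * lam) * Λ0 := by
      field_simp
    rw [hσμ, ← mul_assoc, ← Real.exp_add, neg_add_cancel, Real.exp_zero, one_mul]
  · intro f hfm hfb hfs hGram
    refine ⟨f, fun _ _ => 0, fun a => ?_, ?_⟩
    · -- the trivial split: `u_a = f_a`, `v_a = 0`
      simp only [mul_zero, Finset.sum_const_zero, tubeNormSq_zero_fun, tubeForm_zero_fun, zero_mul, mul_zero, add_zero, sub_self]
      refine ⟨?_, le_rfl, le_rfl, le_rfl, le_rfl⟩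
      by_cases ha : a = 0
      · rw [ha, tubeNormSq_combination_zero]
      · exact (hGram a ha).le
    · -- SLOW MIN–MAX = the tube statement at `ε/2`
      obtain ⟨a, ha, hmain⟩ := hβ0 β hβ0' f hfm hfb hfs hGram
      refine ⟨a, ha, ?_⟩
      have e2 : Real.exp (ε / 4 * lam) * (Real.exp (ε / 4 * lam) * Λ0 / μ0 * μk) = Real.exp (ε / 2 * lam) * μk * Λ0 / μ0 := by
        rw [show ε / 2 * lam = ε / 4 * lam + ε / 4 * lam by ring, Real.exp_add]
        field_simp
      rw [e2, div_mul_eq_mul_div, le_div_iff₀ hμ0]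
      exact hmain

/-- ★ **The tube package is the soft tube statement** (every weight `χ`): `SoftTubeBOPackageAt L χ ↔ SoftTubeNoIntruderAt L χ`.
[cite: Luscher1983, §3] [cite: SjostrandZworski2007, §2] -/
theorem softTubeBOPackageAt_iff (χ : ℝ → GaugeConfig 3 L SU2 → ℝ) : SoftTubeBOPackageAt L χ ↔ SoftTubeNoIntruderAt L χ :=
  ⟨softTubeNoIntruderAt_of_package, softTubeBOPackageAt_of_softTubeNoIntruderAt⟩

/-! ## §2 ★★ The tube package of record is INNER one-orbit -/

/-- ★★ **The tube package of record is INNER one-orbit**: `SoftTubeBOPackageAt L (recordWeight L δ δg) ↔ InnerNoIntruderOneOrbitAt L δ`. [cite: Luscher1983, §3] -/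
theorem softTubeBOPackage_recordWeight_iff_inner {δ : ℝ → ℝ} (hδ : ∀ β, 0 < δ β) (δg : ℝ → ℝ) :
    SoftTubeBOPackageAt L (recordWeight L δ δg) ↔ InnerNoIntruderOneOrbitAt L δ :=
  (softTubeBOPackageAt_iff _).trans (softTube_recordWeight_iff_inner hδ δg)

/-- ★ … and is R18's `InnerBOPackageAt L δ`: all four typed C4 interfaces coincide. [cite: Luscher1983, §3] [cite: SjostrandZworski2007, §2] -/
theorem softTubeBOPackage_recordWeight_iff_innerBOPackage {δ : ℝ → ℝ} (hδ : ∀ β, 0 < δ β) (δg : ℝ → ℝ) :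
    SoftTubeBOPackageAt L (recordWeight L δ δg) ↔ InnerBOPackageAt L δ :=
  (softTubeBOPackage_recordWeight_iff_inner hδ δg).trans (R18.innerBOPackageAt_iff δ).symm

/-- The tube package of record at the exponents of record, every `s, t`. [cite: Luscher1983, §3] -/
theorem softTubeBOPackage_recordWeight_pow_iff (s t : ℝ) :
    SoftTubeBOPackageAt L (recordWeight L (powScale s) (powScale t)) ↔ InnerNoIntruderOneOrbitAt L (powScale s) :=
  softTubeBOPackage_recordWeight_iff_inner (fun β => powScale_pos s β) (powScale t)

/-! ## §3 Hard tubes -/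

omit [NeZero L] in
/-- `𝟙_T(U) ≠ 0 ↔ U ∈ T`. [folklore] -/
theorem indicator_one_ne_zero_iff (T : Set (GaugeConfig 3 L SU2)) (U : GaugeConfig 3 L SU2) :
    T.indicator (fun _ => (1 : ℝ)) U ≠ 0 ↔ U ∈ T := by
  by_cases h : U ∈ T <;> simp [h]

/-- For families supported in `T`, the hard weight `N_T` and the soft weight `N_T/𝟙_T` give the same integrand. [folklore] -/
theorem sq_mul_tubeWeight_eq {T : Set (GaugeConfig 3 L SU2)} {k : ℕ} {f : Fin k → GaugeConfig 3 L SU2 → ℝ}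
    (hfs : ∀ i U, f i U ≠ 0 → U ∈ T) (a : Fin k → ℝ) (U : GaugeConfig 3 L SU2) :
    (∑ i, a i * f i U) ^ 2 * tubeWeight T U = (∑ i, a i * f i U) ^ 2 * softWeight (T.indicator fun _ => (1 : ℝ)) U := by
  by_cases hU : U ∈ T
  · simp only [softWeight, tubeWeight, Set.indicator_of_mem hU, div_one]
  · have h0 : (∑ i, a i * f i U) = 0 := Finset.sum_eq_zero fun i _ => by
      have : f i U = 0 := by
        by_contra h
        exact hU (hfs i U h)
      rw [this, mul_zero]
    rw [h0]; simp

/-- ★ **The hard tube statement is the soft statement of the indicator**: `TubeNoIntruderAt L T ↔ SoftTubeNoIntruderAt L (𝟙_{T ·})`. [cite: SeilerLNP1982, §2] -/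
theorem tubeNoIntruderAt_iff_soft (T : ℝ → Set (GaugeConfig 3 L SU2)) :
    TubeNoIntruderAt L T ↔ SoftTubeNoIntruderAt L (fun β => (T β).indicator fun _ => (1 : ℝ)) := by
  constructor
  · intro h k ε hε
    obtain ⟨β0, hβ0⟩ := h k ε hε
    refine ⟨β0, fun β hβ f hfm hfb hfs hGram => ?_⟩
    have hfs' : ∀ i U, f i U ≠ 0 → U ∈ T β := fun i U hU => (indicator_one_ne_zero_iff (T β) U).mp (hfs i U hU)
    have hw : ∀ a : Fin (k + 1) → ℝ, (fun U => (∑ i, a i * f i U) ^ 2 * tubeWeight (T β) U) =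
        fun U => (∑ i, a i * f i U) ^ 2 * softWeight ((T β).indicator fun _ => (1 : ℝ)) U :=
      fun a => funext fun U => sq_mul_tubeWeight_eq hfs' a U
    have hGram' : ∀ a : Fin (k + 1) → ℝ, a ≠ 0 → 0 < ∫ U, (∑ i, a i * f i U) ^ 2 * tubeWeight (T β) U ∂configMeasure SU2 L :=
      fun a ha => by rw [hw a]; exact hGram a ha
    obtain ⟨a, ha, hle⟩ := hβ0 β hβ f hfm hfb hfs' hGram'
    refine ⟨a, ha, ?_⟩
    rw [← hw a]
    exact hle
  · intro h k ε hε
    obtain ⟨β0, hβ0⟩ := h k ε hε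
    refine ⟨β0, fun β hβ f hfm hfb hfs hGram => ?_⟩
    have hfs' : ∀ i U, f i U ≠ 0 → (T β).indicator (fun _ => (1 : ℝ)) U ≠ 0 :=
      fun i U hU => (indicator_one_ne_zero_iff (T β) U).mpr (hfs i U hU)
    have hw : ∀ a : Fin (k + 1) → ℝ, (fun U => (∑ i, a i * f i U) ^ 2 * tubeWeight (T β) U) =
        fun U => (∑ i, a i * f i U) ^ 2 * softWeight ((T β).indicator fun _ => (1 : ℝ)) U :=
      fun a => funext fun U => sq_mul_tubeWeight_eq hfs a U
    have hGram' : ∀ a : Fin (k + 1) → ℝ, a ≠ 0 →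
        0 < ∫ U, (∑ i, a i * f i U) ^ 2 * softWeight ((T β).indicator fun _ => (1 : ℝ)) U ∂configMeasure SU2 L :=
      fun a ha => by rw [← hw a]; exact hGram a ha
    obtain ⟨a, ha, hle⟩ := hβ0 β hβ f hfm hfb hfs' hGram'
    refine ⟨a, ha, ?_⟩
    rw [hw a]
    exact hle

/-- ★★ **The hard tube statement is INNER one-orbit** for every admissible tube eventually inside the inner region (e.g. every sandwiched tube
`nearOne ρ ∩ {orbitDist < δ β} ⊆ T β ⊆ {orbitDist < δ β}`). [cite: Luscher1983, §3] [cite: SeilerLNP1982, §2–3] -/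
theorem tubeNoIntruderAt_iff_inner {δ : ℝ → ℝ} {T : ℝ → Set (GaugeConfig 3 L SU2)} (hadm : TubeAdmissible L δ T)
    (hsub : ∃ β1 : ℝ, ∀ β : ℝ, β1 ≤ β → T β ⊆ {W | orbitDist W < δ β}) :
    TubeNoIntruderAt L T ↔ InnerNoIntruderOneOrbitAt L δ := by
  refine ⟨innerNoIntruderOneOrbitAt_of_tube hadm, fun hI => (tubeNoIntruderAt_iff_soft T).mpr ?_⟩
  obtain ⟨β1, hβ1⟩ := hsub
  exact softTubeNoIntruderAt_of_inner (fun β => measurable_const.indicator (hadm.1 β)) (fun β => ⟨1, abs_indicator_one_le (T β)⟩)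
    (fun β U => by by_cases h : U ∈ T β <;> simp [h])
    (fun β => ⟨1, one_pos, fun U hU => by rw [Set.indicator_of_mem ((indicator_one_ne_zero_iff (T β) U).mp hU)]⟩)
    ⟨β1, fun β hβ U hU => hβ1 β hβ ((indicator_one_ne_zero_iff (T β) U).mp hU)⟩ hI

end Summit.QuantumFields.YangMills.Theorems.TwistedTraceScaling.Negative.R27b

end
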